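import Summits.BirchSwinnertonDyer.BirchSwinnertonDyer.Theorems.ByReductionTypeAtTwoMultTransportIsogenyQuotientTypeFlip
import HarnessLib

/-!
# T-42 in the kernel, CV — road (S-C′), the UNIFORM theorem (chain induction), piece 1: THE TYPE FLIP FOR EVERY IMAGE OF `W[2]` —
# along the `2`-isogeny `φ : W → V` with connected kernel `{O, P₀}` (type A), EVERY `Q ∈ W[2]` whose image `φ(Q)` is a rational
# point `(x_V, y_V)` of `V` has `¬ TwoTorsionRamifiedAtTwo x_V` (type B) — XCIX §3 WITHOUT the uniqueness hypothesis on `V`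

Cell `bsd-2adic` (run/shared/lean/pub/bsd-2adic/), seat `bsd-2adic-t42` GEN 35 (pen RC-546/548 SUMMON, director (492): the (K-∀)-free UNIFORM
theorem; memo `t42/DESIGN-T42-ADDENDUM-39.md`). HONEST FRAMING: research route; THEOREMS ONLY (no `def`, no named fact, no instance, no
`sorry`); nothing booked; no door or class file is touched (k6); BSD is not proved by any of this. PARTITION: X5@2 multiplicative
GV-transport rows (K4ᵐ B1·O1; items 19922 / 19923) × p = 2 — reduces-the-named-input-of (the side condition / certificate of XCII–XCVIII);
bears_on K4 (`--supports stmt-BirchSwinnertonDyer-19923`).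

## What

XCIX `not_twoTorsionRamifiedAtTwo_of_twoIsogeny_quotient` proves the flip for the UNIQUE rational point of order `2` of `V` (when unique),
using uniqueness only to identify `φ(Q)` (`Q ∈ W[2] ∖ {O, P₀}`) with that point. Along the descent chain of the uniform theorem the
intermediate quotients have FULL rational `2`-torsion, so the identification must be an INPUT instead:

* ★ **`not_twoTorsionRamifiedAtTwo_of_twoIsogeny_apply_eq`** — `W` globally minimal, multiplicative or good ordinary at `2`, `P₀ = (x, y)`
  rational of order `2` of TYPE A, `φ : W → V` (`V` globally minimal) with `φ(P₀) = O`, `ker φ ⊆ {O, P₀}`; then for EVERY `Q ∈ W(ℚ̄)`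
  with `Q + Q = O` and `φ(Q) = (x_V, y_V)` a rational affine point with `2y_V + a₁x_V + a₃ = 0`: `¬ TwoTorsionRamifiedAtTwo x_V`.
  Proof = XCIX §3 verbatim from the point where `φ(Q)` is identified (the Tate / reduction line packages of XCIX §1, the inertia element
  `ζ ↦ ζ³` of XCIX §2, halving in `C_V`, pull-back along `φ`, `(vi)` inertia-triviality of `W[2^∞]/C_W`).
  (XCIX's statement is the case `φ(Q) =` the unique rational point of order `2`; not restated.)

References: [GreenbergVatsal2000] §2 pp. 14–16, p. 28; [GreenbergLNM1716] §2 Prop. 2.4, §5 p. 168 and p. 176; [SilvermanATAEC1994] V.3.1, V.5.2 (c),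
V.5.3, Ex. 5.11; [SilvermanAEC2009] III.4.12, III.6.1–6.2, VII.2, VIII.1; [SerreLocalFields1979] IV §4 Prop. 17.
-/

set_option autoImplicit false
set_option linter.dupNamespace false

noncomputable section

open scoped Classical AddSubgroup

namespace Summit.BirchSwinnertonDyer.BirchSwinnertonDyer.Theorems.MultTransportTwistedDescent

open NumberField IsDedekindDomain Field WeierstrassCurve
  Literature.NumberTheory.GaloisRepresentations Literature.NumberTheory.EllipticCurves
  Literature.NumberTheory.EllipticCurves.GreenbergSelmer IsDedekindDomain.HeightOneSpectrum Rat.HeightOneSpectrum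
  Literature.NumberTheory.EllipticCurves.TateCurve Literature.NumberTheory.EllipticCurves.Greenberg1999
  Literature.NumberTheory.EllipticCurves.Rank1Residual
  Summit.BirchSwinnertonDyer.Rank1Residual Summit.BirchSwinnertonDyer.Rank1Residual.X2
  Summit.BirchSwinnertonDyer.Rank1Residual.X2.GreenbergVatsalReductionDatum
  Summit.BirchSwinnertonDyer.BirchSwinnertonDyer.Theorems.MultTransportAtTwo

section Flip

variable (W : WeierstrassCurve ℚ) [W.IsElliptic] [W.IsGloballyMinimal]
  (V : WeierstrassCurve ℚ) [V.IsElliptic] [V.IsGloballyMinimal]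

/-- ★ **THE TYPE FLIPS ALONG THE `2`-ISOGENY WITH CONNECTED KERNEL — FOR EVERY IMAGE OF `W[2]`** (audit-2 D-NOTE B5-CHAIN@2 §2 (α), kernel,
multiplicative AND good ordinary `2`; XCIX §3 without the uniqueness hypothesis). Let `W/ℚ` be globally minimal, multiplicative or good
ordinary at `2`, with a rational point `P₀ = (x, y)` of order `2` of TYPE A (`TwoTorsionRamifiedAtTwo x`); let `V/ℚ` be globally minimal and
`φ : W → V` a `ℚ`-isogeny with `φ(P₀) = O` and `ker φ ⊆ {O, P₀}`. If `Q ∈ W(ℚ̄)` has `Q + Q = O` and `φ(Q)` is the rational affine point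
`(x_V, y_V)` (`2y_V + a₁x_V + a₃ = 0`), then `¬ TwoTorsionRamifiedAtTwo x_V`: the image of `W[2]` under `φ` avoids the canonical line of `V`.
(`Q ∉ C_W` as `C_W ∩ W[2] = {O, P₀}`; if `φ(Q) ∈ C_V`, halve it in `C_V`, move the half by an inertia element with `χ ≡ 3 (4)`, pull back
along `φ`: inertia-triviality of `W[2^∞]/C_W` forces `Q ∈ C_W`.) [cite: GreenbergVatsal2000, §2 pp. 14–16 and p. 28]
[cite: GreenbergLNM1716, §5 p. 168 and p. 176] [cite: SilvermanATAEC1994, Thm. V.3.1, Lemma V.5.2 (c), Thm. V.5.3] [cite: SilvermanAEC2009, Thm. III.6.2, VII.2, VIII.1] -/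
theorem not_twoTorsionRamifiedAtTwo_of_twoIsogeny_apply_eq (κ : ZpExtension ℚ 2) (hκ : κ.IsCyclotomic)
    (hred : W.HasMultiplicativeReductionAtPrime 2 ∨ IsOrdinaryAt W 2)
    {x y : ℚ} (hxy : W.toAffine.Nonsingular x y) (h2 : 2 * y + W.a₁ * x + W.a₃ = 0) (hA : TwoTorsionRamifiedAtTwo x)
    (φ : Isogeny W V) (hφ0 : φ (toGeomPoints W (.some x y hxy)) = 0)
    (hφker : ∀ P : W.geomPoints, φ P = 0 → P = 0 ∨ P = toGeomPoints W (.some x y hxy))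
    {Q : W.geomPoints} (hQ2 : Q + Q = 0)
    {xV yV : ℚ} (hxyV : V.toAffine.Nonsingular xV yV) (h2V : 2 * yV + V.a₁ * xV + V.a₃ = 0)
    (hφQ : φ Q = toGeomPoints V (.some xV yV hxyV)) :
    ¬ TwoTorsionRamifiedAtTwo xV := by
  haveI : Fact (Nat.Prime 2) := ⟨Nat.prime_two⟩
  intro hAV
  -- the place above `2`
  obtain ⟨v, hv2⟩ : ∃ v : HeightOneSpectrum (𝓞 ℚ), ((2 : ℕ) : 𝓞 ℚ) ∈ v.asIdeal := by
    refine ⟨primesEquiv.symm ⟨2, Nat.prime_two⟩, ?_⟩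
    have h := natCast_natGenerator_mem (primesEquiv.symm ⟨2, Nat.prime_two⟩)
    have hgen : natGenerator (primesEquiv (R := 𝓞 ℚ).symm ⟨2, Nat.prime_two⟩) = 2 :=
      congrArg Subtype.val (primesEquiv.apply_symm_apply (⟨2, Nat.prime_two⟩ : Nat.Primes))
    rw [hgen] at h
    exact h
  -- `V` is multiplicative / good ordinary at `2` as well
  have hredV : V.HasMultiplicativeReductionAtPrime 2 ∨ IsOrdinaryAt V 2 := mult_or_ord_of_isIsogenous W V ⟨φ⟩ hred
  -- the two line packages
  obtain ⟨NW, hcardW, hdictW, htrivW⟩ := exists_line_card_dict_htriv_two W κ hκ hred hv2 hxy h2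
  obtain ⟨NV, hdivV, hInertV, hdictV⟩ := exists_line_div_inert_dict_two V κ hκ hredV hv2 hxyV h2V
  -- ### `W`-side: `P₀ ∈ C_W`, and `C_W ∩ W[2] = {0, P₀}`
  set P₀ : W.geomPoints := toGeomPoints W (.some x y hxy) with hP₀def
  have hP₀2 : P₀ + P₀ = 0 := by
    obtain ⟨y₁, h₁, P₁, hP₁, -, -, h2₁⟩ := exists_geomTorsion_two_of_hasRationalTwoTorsionX W ⟨y,
      (WeierstrassCurve.Affine.equation_iff_nonsingular).mpr hxy, h2⟩
    obtain rfl : y₁ = y := by linarith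
    have hP₁g : (P₁ : W.geomPoints) = P₀ := by
      rw [hP₁, hP₀def]
      exact (some_eq_some_geomPoints W (X₁ := algebraMap ℚ (AlgebraicClosure ℚ) x) (Y₁ := algebraMap ℚ (AlgebraicClosure ℚ) y₁)
        (h₁ := (WeierstrassCurve.Affine.baseChange_nonsingular (W := W.toAffine) (Algebra.ofId ℚ (AlgebraicClosure ℚ)).injective ..).mpr hxy)
        (eq_ratCast _ x) (eq_ratCast _ y₁)).symm
    rw [← hP₁g, ← AddSubgroup.coe_add, add_self_geomTorsion_two W P₁, ZeroMemClass.coe_zero]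
  have hP₀ne : P₀ ≠ 0 := by
    rw [hP₀def]
    intro h
    exact WeierstrassCurve.Affine.Point.some_ne_zero hxy (toGeomPoints_injective W (by rw [h, map_zero]))
  have hmem2 : ∀ {P : W.geomPoints}, P + P = 0 → P ∈ W.geomPrimaryTorsion 2 := fun {P} hP ↦
    (AddCommGroup.mem_primaryComponent).mpr ⟨1, by rw [pow_one, two_nsmul]; exact hP⟩
  have hP₀C : (⟨P₀, hmem2 hP₀2⟩ : W.geomPrimaryTorsion 2) ∈ NW.plus := (hdictW ⟨P₀, hmem2 hP₀2⟩ rfl).2 hA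
  -- every `2`-torsion element of `C_W` is `0` or `P₀`
  have hCW2 : ∀ m : W.geomPrimaryTorsion 2, m ∈ NW.plus → (m : W.geomPoints) + m = 0 → (m : W.geomPoints) = 0 ∨ (m : W.geomPoints) = P₀ := by
    intro m hm hm2
    by_contra hnot
    push Not at hnot
    have htor : ∀ {P : W.geomPoints} (hP : P + P = 0), (⟨P, hmem2 hP⟩ : W.geomPrimaryTorsion 2) ∈ (↥(W.geomPrimaryTorsion 2))[(2 : ℤ)] :=
      fun {P} hP ↦ (Submodule.mem_torsionBy_iff (2 : ℤ) _).mpr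
        (by rw [two_zsmul]; exact Subtype.ext (by rw [AddSubgroup.coe_add, ZeroMemClass.coe_zero]; exact hP))
    let e0 : ↥(NW.plus ⊓ (↥(W.geomPrimaryTorsion 2))[(2 : ℤ)]) := ⟨0, (NW.plus ⊓ _).zero_mem⟩
    let eP : ↥(NW.plus ⊓ (↥(W.geomPrimaryTorsion 2))[(2 : ℤ)]) := ⟨⟨P₀, hmem2 hP₀2⟩, hP₀C, htor hP₀2⟩
    have hm' : m = ⟨(m : W.geomPoints), hmem2 hm2⟩ := Subtype.ext rfl
    let em : ↥(NW.plus ⊓ (↥(W.geomPrimaryTorsion 2))[(2 : ℤ)]) := ⟨⟨(m : W.geomPoints), hmem2 hm2⟩, hm' ▸ hm, htor hm2⟩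
    obtain ⟨u, -, huniq⟩ := (Nat.card_eq_two_iff' e0).mp hcardW
    have hP : eP = u := huniq eP (fun h ↦ hP₀ne (by simpa [eP, e0] using congrArg (fun z ↦ ((z.1 : W.geomPrimaryTorsion 2) : W.geomPoints)) h))
    have hM : em = u := huniq em (fun h ↦ hnot.1 (by simpa [em, e0] using congrArg (fun z ↦ ((z.1 : W.geomPrimaryTorsion 2) : W.geomPoints)) h))
    exact hnot.2 (by simpa [em, eP] using congrArg (fun z ↦ ((z.1 : W.geomPrimaryTorsion 2) : W.geomPoints)) (hM.trans hP.symm))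
  -- ### `Q` is off `{0, P₀}` (its image is a non-zero point), hence off `C_W`
  have hφQ0 : φ Q ≠ 0 := by
    rw [hφQ]
    intro h
    exact WeierstrassCurve.Affine.Point.some_ne_zero hxyV (toGeomPoints_injective V (by rw [h, map_zero]))
  have hQ0 : Q ≠ 0 := fun h ↦ hφQ0 (by rw [h, map_zero])
  have hQP : Q ≠ P₀ := fun h ↦ hφQ0 (by rw [h]; exact hφ0)
  have hQC : (⟨Q, hmem2 hQ2⟩ : W.geomPrimaryTorsion 2) ∉ NW.plus := fun h ↦ by
    rcases hCW2 _ h hQ2 with h0 | hP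
    · exact hQ0 h0
    · exact hQP hP
  have hφQ2 : φ Q + φ Q = 0 := by rw [← map_add, hQ2, map_zero]
  -- ### `V`-side: `φ Q ∈ C_V` (type A on `V`, to be refuted); halve it and move it by inertia
  have hmem2V : ∀ {P : V.geomPoints}, P + P = 0 → P ∈ V.geomPrimaryTorsion 2 := fun {P} hP ↦
    (AddCommGroup.mem_primaryComponent).mpr ⟨1, by rw [pow_one, two_nsmul]; exact hP⟩
  have hφQC : (⟨φ Q, hmem2V hφQ2⟩ : V.geomPrimaryTorsion 2) ∈ NV.plus := (hdictV ⟨φ Q, hmem2V hφQ2⟩ hφQ).2 hAV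
  obtain ⟨S, hSC, h2S⟩ := hdivV _ hφQC
  have h4S : 2 ^ 2 • S = 0 := by
    rw [show (2 : ℕ) ^ 2 = 2 * 2 from rfl, mul_smul, h2S]
    exact Subtype.ext (by rw [AddSubmonoidClass.coe_nsmul, ZeroMemClass.coe_zero, two_nsmul]; exact hφQ2)
  obtain ⟨σ, hσI, hσ4⟩ := exists_mem_absInertia_units_map_eq_pow_three hv2
  have hσS : resGal (K := ℚ) (v.adicCompletion ℚ) σ • S = 3 • S := hInertV σ hσI 2 3 hσ4 S hSC h4S
  have hσS' : resGal (K := ℚ) (v.adicCompletion ℚ) σ • S - S = ⟨φ Q, hmem2V hφQ2⟩ := by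
    rw [hσS, ← h2S, show (3 : ℕ) = 2 + 1 from rfl, add_nsmul, one_nsmul, add_sub_cancel_right]
  -- ### pull `S` back along `φ` and conclude on `W`
  obtain ⟨T₀, hT₀⟩ := φ.surjective (S : V.geomPoints)
  have hT₀8 : 2 ^ 3 • T₀ = 0 := by
    have h4 : φ (2 ^ 2 • T₀) = 0 := by
      rw [map_nsmul, hT₀, ← AddSubmonoidClass.coe_nsmul, h4S, ZeroMemClass.coe_zero]
    rcases hφker _ h4 with h0 | hP
    · rw [show (2 : ℕ) ^ 3 = 2 * 2 ^ 2 from rfl, mul_smul, h0, smul_zero]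
    · rw [show (2 : ℕ) ^ 3 = 2 * 2 ^ 2 from rfl, mul_smul, hP, two_nsmul, hP₀2]
  let T : W.geomPrimaryTorsion 2 := ⟨T₀, (AddCommGroup.mem_primaryComponent).mpr ⟨3, hT₀8⟩⟩
  have hfT : primaryTorsionMap 2 φ.toAddMonoidHom T = S := Subtype.ext (by rw [coe_primaryTorsionMap_apply]; exact hT₀)
  set τ : absoluteGaloisGroup ℚ := resGal (K := ℚ) (v.adicCompletion ℚ) σ with hτdef
  have hτI : τ ∈ inertia v := by
    rw [hτdef, resGal_eq_absGaloisRestrict]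
    exact Subgroup.mem_map.2 ⟨σ, hσI, rfl⟩
  -- `φ (τT − T − Q) = 0`
  have hdiffC : τ • T - T ∈ NW.plus := htrivW τ hτI T
  have hφdiff : φ ((τ • T - T : W.geomPrimaryTorsion 2) : W.geomPoints) = φ Q := by
    have h := congrArg (fun m : V.geomPrimaryTorsion 2 ↦ (m : V.geomPoints)) hσS'
    dsimp only at h
    rw [← hfT, ← primaryTorsionMap_smul 2 φ.toAddMonoidHom φ.equivariant, ← map_sub, coe_primaryTorsionMap_apply] at h
    exact h
  have hkerQ : ((τ • T - T : W.geomPrimaryTorsion 2) : W.geomPoints) - Q = 0 ∨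
      ((τ • T - T : W.geomPrimaryTorsion 2) : W.geomPoints) - Q = P₀ :=
    hφker _ (by rw [map_sub, hφdiff, sub_self])
  -- in both cases `Q ∈ C_W`
  apply hQC
  rcases hkerQ with h0 | hP
  · have hQeq : (⟨Q, hmem2 hQ2⟩ : W.geomPrimaryTorsion 2) = τ • T - T := Subtype.ext (sub_eq_zero.mp h0).symm
    rw [hQeq]; exact hdiffC
  · have hQeq : (⟨Q, hmem2 hQ2⟩ : W.geomPrimaryTorsion 2) = (τ • T - T) - ⟨P₀, hmem2 hP₀2⟩ :=
      Subtype.ext (by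
        rw [AddSubgroupClass.coe_sub]
        exact eq_sub_of_add_eq (by rw [eq_add_of_sub_eq hP, add_comm]))
    rw [hQeq]; exact NW.plus.sub_mem hdiffC hP₀C

end Flip

end Summit.BirchSwinnertonDyer.BirchSwinnertonDyer.Theorems.MultTransportTwistedDescent

end
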